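import Literature.Analysis.FunctionSpaces.Mollification
import Mathlib.MeasureTheory.Function.ContinuousMapDense
import HarnessLib

/-!
# Mollification converges in `L^p`

Analysis/FunctionSpaces support file (serves the discharge of the Serrin–Prodi weak–strong
uniqueness theorem `Literature.Analysis.FluidPDE.weak_strong_uniqueness`: density arguments in `L²`/`H¹` and the
convergence of time-mollified Leray–Hopf solutions; Serrin 1963, §§3–4).

Let `G` be a finite-dimensional real normed space with an additive Haar measure `μ`, `F` a real
Banach space, `φᵢ` normalised bump functions (`ContDiffBump.normed`, unit mass, support the ball of
radius `rOut`) whose outer radii tend to `0` along a filter `l`, and `f ∈ L^p(μ; F)` with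
`1 ≤ p < ∞`. We prove the textbook fact (Adams–Fournier, *Sobolev Spaces*, Lemma 2.18 (c) / Thm.
2.29 (c); Evans, *PDE*, App. C.4, Thm. 7 (iv)):

* `Literature.Analysis.FunctionSpaces.tendsto_eLpNorm_normed_convolution_sub_self`: `‖φᵢ ⋆ f - f‖_{L^p} → 0`.

Proof as printed: approximate `f` in `L^p` by a continuous compactly supported `g` (Mathlib's
`MemLp.exists_hasCompactSupport_eLpNorm_sub_le`); `φᵢ ⋆ g → g` uniformly by uniform continuity
(`ContDiffBump.dist_normed_convolution_le`) on a fixed compact set containing all supports, hence in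
`L^p`; and `‖φᵢ ⋆ (f - g)‖_p ≤ ‖f - g‖_p` by Young's inequality (the tree's
`Literature.Analysis.UnboundedOperators.eLpNorm_convolution_le_lintegral_enorm_mul`), so a `3ε` argument concludes. Also recorded: the
unit mass `∫⁻ ‖φ.normed μ‖ₑ ∂μ = 1` and the Young contraction for a general Haar measure
(`lintegral_enorm_normed_haar`, `eLpNorm_normed_convolution_le_haar`; the `volume` versions are in
`Mollification`).

## Mathlib search

Mathlib (this pin) has pointwise/uniform convergence of `φᵢ ⋆ g` for continuous `g`
(`ContDiffBump.convolution_tendsto_right`, `dist_normed_convolution_le`) and a.e. convergence for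
locally integrable `g` (`ae_convolution_tendsto_right_of_locallyIntegrable`), and the density of
continuous compactly supported functions in `L^p` (`MemLp.exists_hasCompactSupport_eLpNorm_sub_le`),
but no `L^p` convergence of mollification (searched `tendsto`/`eLpNorm` in `Analysis/Convolution`,
`Analysis/Calculus/BumpFunction`).

## References

* R. A. Adams, J. J. F. Fournier, *Sobolev Spaces*, 2nd ed. (Academic Press 2003), Thm. 2.29 (c)
  (mollifiers converge in `L^p`).
* L. C. Evans, *Partial Differential Equations*, 2nd ed. (AMS 2010), App. C.4, Thm. 7 (iv).
* J. Serrin, *The initial value problem for the Navier–Stokes equations*, in: Nonlinear Problems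
  (Madison 1962), Univ. Wisconsin Press 1963, §3.
-/

noncomputable section

open MeasureTheory TopologicalSpace Set Function Filter Topology ContinuousLinearMap Metric
open scoped ENNReal NNReal Convolution Pointwise

namespace Literature.Analysis.FunctionSpaces

variable {G : Type*} [NormedAddCommGroup G] [NormedSpace ℝ G] [FiniteDimensional ℝ G]
  [MeasurableSpace G] [BorelSpace G] {μ : Measure G} [μ.IsAddHaarMeasure]
variable {F : Type*} [NormedAddCommGroup F] [NormedSpace ℝ F] [CompleteSpace F]

/-- The normalised bump kernel has unit mass in `ℝ≥0∞` for any additive Haar measure: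
`∫⁻ ‖φ.normed μ‖ₑ ∂μ = 1`. [folklore] -/
theorem lintegral_enorm_normed_haar (φ : ContDiffBump (0 : G)) :
    ∫⁻ y, ‖φ.normed μ y‖ₑ ∂μ = 1 := by
  have h : ∀ y, ‖φ.normed μ y‖ₑ = ENNReal.ofReal (φ.normed μ y) := fun y =>
    Real.enorm_eq_ofReal (φ.nonneg_normed y)
  simp_rw [h]
  rw [← ofReal_integral_eq_lintegral_ofReal φ.integrable_normed
    (Eventually.of_forall φ.nonneg_normed), φ.integral_normed, ENNReal.ofReal_one]

omit [CompleteSpace F] in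
/-- Mollification by a normalised bump kernel does not increase `L^p` norms, `1 ≤ p ≤ ∞`, for any
additive Haar measure (Young's inequality with `‖φ‖₁ = 1`; Adams–Fournier, Thm. 2.29 (b)). [cite: AdamsFournier2003, Thm. 2.29 (b)] -/
theorem eLpNorm_normed_convolution_le_haar (φ : ContDiffBump (0 : G)) {h : G → F}
    (hh : AEStronglyMeasurable h μ) {p : ℝ≥0∞} (hp : 1 ≤ p) :
    eLpNorm (φ.normed μ ⋆[lsmul ℝ ℝ, μ] h) p μ ≤ eLpNorm h p μ := by
  have := UnboundedOperators.eLpNorm_convolution_le_lintegral_enorm_mul (μ := μ) (K := φ.normed μ)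
    φ.continuous_normed.aestronglyMeasurable hh hp
  rwa [lintegral_enorm_normed_haar, one_mul] at this

/-- Uniform approximation of a uniformly continuous function by its mollification, in the form
used below: if `dist (g a) (g b) ≤ η` whenever `dist a b < δ`, then `‖(φ ⋆ g)(x) - g(x)‖ ≤ η` for
every `x` as soon as `φ.rOut ≤ δ` (Adams–Fournier, Thm. 2.29 (a); Mathlib's
`ContDiffBump.dist_normed_convolution_le`). [cite: AdamsFournier2003, Thm. 2.29 (a)] -/
theorem norm_normed_convolution_sub_self_le (φ : ContDiffBump (0 : G)) {g : G → F}
    (hg : Continuous g) {η δ : ℝ} (hδ : ∀ a b, dist a b < δ → dist (g a) (g b) ≤ η)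
    (hφ : φ.rOut ≤ δ) (x : G) :
    ‖(φ.normed μ ⋆[lsmul ℝ ℝ, μ] g) x - g x‖ ≤ η := by
  rw [← dist_eq_norm]
  refine ContDiffBump.dist_normed_convolution_le hg.aestronglyMeasurable fun y hy => ?_
  exact hδ y x (lt_of_lt_of_le (mem_ball.1 hy) hφ)

omit [CompleteSpace F] in
/-- The mollification of a compactly supported function by a kernel of outer radius `≤ 1` is
supported in the fixed compact set `closedBall 0 1 + tsupport g` (Adams–Fournier, Thm. 2.29 (a):
`supp (J_ε ⋆ u) ⊆ supp u + B_ε`). [cite: AdamsFournier2003, Thm. 2.29 (a)] -/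
theorem normed_convolution_eq_zero_of_not_mem (φ : ContDiffBump (0 : G)) (hφ : φ.rOut ≤ 1)
    {g : G → F} {x : G} (hx : x ∉ closedBall (0 : G) 1 + tsupport g) :
    (φ.normed μ ⋆[lsmul ℝ ℝ, μ] g) x = 0 := by
  by_contra h
  have hx' : x ∈ support (φ.normed μ ⋆[lsmul ℝ ℝ, μ] g) := h
  have h1 := support_convolution_subset (L := lsmul ℝ ℝ) (μ := μ) (f := φ.normed μ) (g := g) hx'
  rw [φ.support_normed_eq] at h1
  obtain ⟨a, ha, b, hb, rfl⟩ := h1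
  refine hx ⟨a, ?_, b, subset_tsupport _ hb, rfl⟩
  exact mem_closedBall.2 ((mem_ball.1 ha).le.trans hφ)

/-- **Mollification converges in `L^p`.** Let `μ` be an additive Haar measure on a
finite-dimensional real normed space `G`, `1 ≤ p < ∞`, `f ∈ L^p(μ; F)`, and let `φᵢ` be bump
functions centred at `0` with `rOut(φᵢ) → 0` along `l`. Then `‖φᵢ.normed ⋆ f - f‖_{L^p(μ)} → 0`
(Adams–Fournier, *Sobolev Spaces*, Thm. 2.29 (c); Evans, *PDE*, App. C.4, Thm. 7 (iv)). Proof as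
printed: `3ε` argument through a continuous compactly supported `g` with `‖f - g‖_p ≤ ε/3`
(density), Young's contraction `‖φᵢ ⋆ (f - g)‖_p ≤ ‖f - g‖_p`, and uniform convergence
`φᵢ ⋆ g → g` on the fixed compact set `closedBall 0 1 + supp g`. [cite: AdamsFournier2003, Thm. 2.29 (c)] -/
theorem tendsto_eLpNorm_normed_convolution_sub_self {ι : Type*} {φ : ι → ContDiffBump (0 : G)}
    {l : Filter ι} (hφ : Tendsto (fun i => (φ i).rOut) l (𝓝 0)) {p : ℝ≥0∞} (hp : 1 ≤ p)
    (hp' : p ≠ ∞) {f : G → F} (hf : MemLp f p μ) :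
    Tendsto (fun i => eLpNorm ((φ i).normed μ ⋆[lsmul ℝ ℝ, μ] f - f) p μ) l (𝓝 0) := by
  have hp0 : p ≠ 0 := (zero_lt_one.trans_le hp).ne'
  rw [ENNReal.tendsto_nhds_zero]
  intro ε hε
  rcases eq_or_ne ε ∞ with rfl | hεtop
  · exact Eventually.of_forall fun _ => le_top
  -- Step 1: a continuous compactly supported `g` with `‖f - g‖_p ≤ ε / 3`.
  have hε3 : ε / 3 ≠ 0 := (ENNReal.div_pos hε.ne' (by norm_num)).ne'
  obtain ⟨g, hgc, hfg, hgcont, hgp⟩ := hf.exists_hasCompactSupport_eLpNorm_sub_le hp' hε3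
  have hfl : LocallyIntegrable f μ := hf.locallyIntegrable hp
  have hgl : LocallyIntegrable g μ := hgp.locallyIntegrable hp
  have hfgl : LocallyIntegrable (f - g) μ := hfl.sub hgl
  -- Step 2: the compact set carrying all `φᵢ ⋆ g - g` and the height `η`.
  set S : Set G := closedBall (0 : G) 1 + tsupport g with hS_def
  have hS : IsCompact S := (isCompact_closedBall 0 1).add hgc
  have hSμ : μ S < ∞ := hS.measure_lt_top
  set A : ℝ≥0∞ := μ S ^ (1 / p.toReal) with hA
  have hAtop : A ≠ ∞ := ENNReal.rpow_ne_top_of_nonneg (by positivity) hSμ.ne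
  set η' : ℝ≥0∞ := ε / 3 / (A + 1) with hη'
  have hA1 : A + 1 ≠ 0 := by simp
  have hA1' : A + 1 ≠ ∞ := by simp [hAtop]
  have hη'top : η' ≠ ∞ := ENNReal.div_ne_top (ENNReal.div_ne_top hεtop (by norm_num)) hA1
  have hη'pos : 0 < η' := ENNReal.div_pos hε3 hA1'
  have hη'A : η' * A ≤ ε / 3 := by
    calc η' * A ≤ η' * (A + 1) := by gcongr; exact le_self_add
      _ = ε / 3 := ENNReal.div_mul_cancel hA1 hA1'
  set η : ℝ := η'.toReal with hη
  have hηpos : 0 < η := ENNReal.toReal_pos hη'pos.ne' hη'top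
  have hηof : ENNReal.ofReal η = η' := ENNReal.ofReal_toReal hη'top
  -- Step 3: uniform continuity of `g`.
  have hguc : UniformContinuous g := hgc.uniformContinuous_of_continuous hgcont
  obtain ⟨δ, hδpos, hδ⟩ := Metric.uniformContinuous_iff.1 hguc η hηpos
  -- Step 4: eventually `rOut < min δ 1`, and then the estimate.
  have hev : ∀ᶠ i in l, (φ i).rOut < min δ 1 :=
    (tendsto_order.1 hφ).2 _ (lt_min hδpos one_pos)
  filter_upwards [hev] with i hi
  have hiδ : (φ i).rOut ≤ δ := (hi.trans_le (min_le_left _ _)).le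
  have hi1 : (φ i).rOut ≤ 1 := (hi.trans_le (min_le_right _ _)).le
  set K : G → ℝ := (φ i).normed μ with hK
  -- (a) the middle term `‖K ⋆ g - g‖_p ≤ η' * A ≤ ε / 3`
  have hmid_pt : ∀ x, ‖(K ⋆[lsmul ℝ ℝ, μ] g - g) x‖ ≤ ‖S.indicator (fun _ => η) x‖ := by
    intro x
    by_cases hx : x ∈ S
    · rw [indicator_of_mem hx, Real.norm_of_nonneg hηpos.le, Pi.sub_apply]
      exact norm_normed_convolution_sub_self_le (φ i) hgcont
        (fun a b hab => (hδ hab).le) hiδ x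
    · have h1 : (K ⋆[lsmul ℝ ℝ, μ] g) x = 0 := normed_convolution_eq_zero_of_not_mem (φ i) hi1 hx
      have h2 : g x = 0 := by
        refine image_eq_zero_of_notMem_tsupport fun hx' => hx ?_
        exact ⟨0, mem_closedBall_self zero_le_one, x, hx', zero_add x⟩
      simp [Pi.sub_apply, h1, h2, indicator_of_notMem hx]
  have hmid : eLpNorm (K ⋆[lsmul ℝ ℝ, μ] g - g) p μ ≤ ε / 3 := by
    calc eLpNorm (K ⋆[lsmul ℝ ℝ, μ] g - g) p μ ≤ eLpNorm (S.indicator fun _ => η) p μ :=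
          eLpNorm_mono hmid_pt
      _ = ‖η‖ₑ * μ S ^ (1 / p.toReal) := eLpNorm_indicator_const hS.measurableSet hp0 hp'
      _ = η' * A := by rw [Real.enorm_eq_ofReal hηpos.le, hηof]
      _ ≤ ε / 3 := hη'A
  -- (b) the first term by Young's contraction
  have hfirst : eLpNorm (K ⋆[lsmul ℝ ℝ, μ] (f - g)) p μ ≤ ε / 3 :=
    (eLpNorm_normed_convolution_le_haar (φ i) hfgl.aestronglyMeasurable hp).trans hfg
  -- (c) the last term
  have hlast : eLpNorm (g - f) p μ ≤ ε / 3 := by rwa [eLpNorm_sub_comm]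
  -- (d) the decomposition `K ⋆ f - f = K ⋆ (f - g) + ((K ⋆ g - g) + (g - f))`
  have hdec : K ⋆[lsmul ℝ ℝ, μ] f - f =
      K ⋆[lsmul ℝ ℝ, μ] (f - g) + ((K ⋆[lsmul ℝ ℝ, μ] g - g) + (g - f)) := by
    ext x
    have e1 : ConvolutionExistsAt K (f - g) x (lsmul ℝ ℝ) μ :=
      (φ i).hasCompactSupport_normed.convolutionExists_left _ (φ i).continuous_normed hfgl x
    have e2 : ConvolutionExistsAt K g x (lsmul ℝ ℝ) μ :=
      (φ i).hasCompactSupport_normed.convolutionExists_left _ (φ i).continuous_normed hgl x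
    have hsum : (K ⋆[lsmul ℝ ℝ, μ] ((f - g) + g)) x =
        (K ⋆[lsmul ℝ ℝ, μ] (f - g)) x + (K ⋆[lsmul ℝ ℝ, μ] g) x := e1.distrib_add e2
    rw [sub_add_cancel] at hsum
    simp only [Pi.sub_apply, Pi.add_apply, hsum]
    abel
  -- (e) measurability of the summands and the triangle inequality
  have hm1 : AEStronglyMeasurable (K ⋆[lsmul ℝ ℝ, μ] (f - g)) μ :=
    ((φ i).hasCompactSupport_normed.continuous_convolution_left _ (φ i).continuous_normed
      hfgl).aestronglyMeasurable
  have hm2 : AEStronglyMeasurable (K ⋆[lsmul ℝ ℝ, μ] g - g) μ :=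
    ((φ i).hasCompactSupport_normed.continuous_convolution_left _ (φ i).continuous_normed
      hgl).aestronglyMeasurable.sub hgcont.aestronglyMeasurable
  have hm3 : AEStronglyMeasurable (g - f) μ :=
    hgcont.aestronglyMeasurable.sub hf.aestronglyMeasurable
  calc eLpNorm (K ⋆[lsmul ℝ ℝ, μ] f - f) p μ
      = eLpNorm (K ⋆[lsmul ℝ ℝ, μ] (f - g) + ((K ⋆[lsmul ℝ ℝ, μ] g - g) + (g - f))) p μ := by
        rw [hdec]
    _ ≤ eLpNorm (K ⋆[lsmul ℝ ℝ, μ] (f - g)) p μ +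
          eLpNorm ((K ⋆[lsmul ℝ ℝ, μ] g - g) + (g - f)) p μ := eLpNorm_add_le hm1 (hm2.add hm3) hp
    _ ≤ eLpNorm (K ⋆[lsmul ℝ ℝ, μ] (f - g)) p μ +
          (eLpNorm (K ⋆[lsmul ℝ ℝ, μ] g - g) p μ + eLpNorm (g - f) p μ) := by
        gcongr
        exact eLpNorm_add_le hm2 hm3 hp
    _ ≤ ε / 3 + (ε / 3 + ε / 3) := by gcongr
    _ = ε := by rw [← add_assoc, ENNReal.add_thirds]

end Literature.Analysis.FunctionSpaces
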